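import Mathlib
import HarnessLib
import Summits.HubbardSuperconductivity.HubbardSuperconductivity.Theorems.KLProgrammeKLRegimeEngineTowerWtNumericsBounds
import Summits.HubbardSuperconductivity.HubbardSuperconductivity.Theorems.KLProgrammeKLRegimeEngineTowerWtNumericsPins
import Summits.HubbardSuperconductivity.HubbardSuperconductivity.Theorems.KLProgrammeKLRegimeEngineTowerLevNumericsBounds
import Summits.HubbardSuperconductivity.HubbardSuperconductivity.Theorems.KLProgrammeKLRegimeEngineTowerLevNumericsG

/-!
# Route `KLProgramme` — crux K3 ENGINE (stmt-HubbardSuperconductivity-20437 `KLRegimeEngineV17F2`), stub (b) v2, THE WEIGHTED HALF «(b)-WT4», numerics side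
# «part 4» (d) (cell gate-hubbard-kl, seat p4 g22): THE MAIN WEIGHTED TOWER's NUMERICS PACKAGE — W10's `[p4]` rows DISCHARGED on shapes: the law constants
# `A Q′`, the profile `A′ Q″` with its four dominations, the eight kit rows at every `λ ≤ uf`, and the CE row (SHARP read-out shapes, W7b♯)

W10 (`kernelNormsWt4_all_klEng_structural`, k3c3-p2 g17, p703207) leaves to the numerics: `∀ (B A Q′ Ab Qb), 1 ≤ B, 0 ≤ A, 0 < Q′, …`, the dominants of the
names (taken at the max-constants, …TowerWtNumericsPins), `∀ (A′ Q″)` with `W(C₁/C₂)8^{d−1}(Ab + A/(1−2^{−d})) ≤ A′`, `Z·C₂²(2^{d−1})⁻¹·max Q′ Qb ≤ Q″`, `W·Ab ≤ A′`,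
`Z·Qb ≤ Q″`, `0 < Q″`, the eight kit rows at every read-out rate, and the CE row; it PINS the imports `ι₁ = i₁(M/β)`, `ι₂ = i₂(M/β)³`, `ι₃ = x₆(M/β)⁵`.
CHOICES (the tree's generic (I5) file …TowerLevNumericsG, equational binders): `κ_A = W·((C₁/C₂)·8^{d−1})`, base floor `q₀ = q₀₀·(M/β)²`, `Q″ = Z·Qb + q₀ + 1`,
`ρ = max 4 (2τψ)`, `Q′ = ρ·Q″`, `a = W·Ab + κ_A·Ab`, `X = ι₃/(WZ³)`, `Y = ι₂/(2Q″) + WZ³X/(4Q″²) + aQ″/2`, `A = 2Y(1−2^{−d})/(κ_A Q″)`, `A′ = a + 2Y/Q″`; the base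
amplitude `Ab = ab·(β/M)/Bf²` (block 0's domination), `0 ≤ Qb ≤ qb·(M/β)²`.  CLOSED FORMS (r-free, `rfl` at the call): pins `pW pZ ps pt pp pφ pρ pκ`, the two
amplitude ratios `K₁ = 8pφpt`, `K₂ = 128e·pp³pt⁴pφpκ/((1−2^{−d})pρ³)`, `Kx = max K₁ K₂`, **`q₀₀ = 1 + (i₂ + x₆)·Kx`** (absorbs the pinned imports),
`QH = pZ·qb + q₀₀ + 1`, **`BfW = (pW + pκ)·ab·QH·Kx`** (the main weighted B-threshold; any `Bf ≥ max 1 BfW`), `yP yL aP aA aL i₃g sC Sfive R₆ R₇`,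
**`uf`** (seven doors), `qT aT`, **`CEf = qT·Bf·max 1 (2aT)`**; blocking `max 1 pZ·C₂²·pρ ≤ 2^{d−1}` as a hypothesis (the glue picks `d ≥ d₀`).
**`levNumerics_packageW`** ⊢ `0 < uf ∧ 0 ≤ CEf ∧ 1 ≤ Bf` and for all `0 < β ≤ M` and the shaped/pinned data: (o) signs and W10's FOUR DOMINATIONS; (i) for every
`0 ≤ λ ≤ uf` the EIGHT KIT ROWS of W10 verbatim (via `towerLevNumericsG_side_of_lam_le` at `ι₃ᴳ = WZ³X + A′Q″³` and `levNumW_rows_mono` down to the pinned `ι₃`);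
(ii) the CE row `Qtot·ε_x²·Bf·max 1 (Atot/ε_x) ≤ CEf` in the SHARP read-out shapes (`levNumW_Atot_le`/`levNumW_Qtot_le`; the unsharp W7b row is not M-uniform,
«(b)-WT4-READOUT-CE-DIM»).  Pure real arithmetic; nothing about the model is asserted; nothing asserts (b), WT4, (ℓ), any stub, K3 or superconductivity.
References: BGM 2006 §2.8 (2.83)–(2.84), (2.93)–(2.98), Lemma 2.5 (2.98) [cite: BenfattoGiulianiMastropietro2006].
-/

noncomputable section

namespace Summit.HubbardSuperconductivity.HubbardSuperconductivity.Theorems.EngineV8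

set_option linter.dupNamespace false -- summit = problem name (single-conjunct summit), D-0017

open Real Literature.MathematicalPhysics.QuantumLattice
open Summit.HubbardSuperconductivity.HubbardSuperconductivity.Theorems.KLRegimeSplit

set_option maxHeartbeats 2000000 in -- one ~70-binder statement, ~40 constants, NumericsG instantiated twice (measured: 1.6M too small)
/-- **THE MAIN WEIGHTED TOWER's NUMERICS PACKAGE** (see the module docstring for the choices, the closed forms and the conclusions (o)–(ii)).
[cite: BenfattoGiulianiMastropietro2006, §2.8 (2.83)-(2.84), (2.93)-(2.98), Lemma 2.5 (2.98)] -/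
theorem levNumerics_packageW
    {C₁ C₂ C₁r C₂r Cinc Dinc Cκ Cb CJ ab qb i₁ i₂ x₆ : ℝ} {d : ℕ}
    (hC₁ : 0 < C₁) (hC₂ : 0 < C₂) (hC₁r : 0 < C₁r) (hC₂r : 0 < C₂r) (hCinc : 0 < Cinc) (hDinc : 1 ≤ Dinc)
    (hCκ : 0 < Cκ) (hCb : 0 < Cb) (hCJ : 0 < CJ) (hd : 2 ≤ d) (hab0 : 0 < ab) (hqb0 : 0 < qb) (hi₁ : 0 ≤ i₁) (hi₂ : 0 ≤ i₂) (hx₆ : 0 ≤ x₆)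
    -- the r-free closed forms (instantiate with `rfl`)
    {pW pZ ps pt pp pφ pρ pκ K₁ K₂ Kx q₀₀ QH BfW yP yL aP aA aL i₃g sC Sfive R₆ R₇ uf qT aT CEf : ℝ} {Bf : ℝ}
    (hpW : pW = 16) (hpZ : pZ = (81 * CJ) ^ 2 / 8) (hps : ps = 2 * Cκ * klE0 / (162 ^ 2 * CJ ^ 2))
    (hpt : pt = 4 * exp 4 * (2 * Cκ * klE0) / (162 ^ 2 * CJ ^ 2)) (hpp : pp = 162 ^ 2 * CJ ^ 2 / (2 * Cκ * klE0))
    (hpφ : pφ = exp 1 * (Cb * (4 : ℝ) ^ d / klE0) / (Cκ * klE0)) (hpρ : pρ = 8 * exp 4) (hpκ : pκ = pW * ((C₁ / C₂) * (8 : ℝ) ^ (d - 1)))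
    (hK₁ : K₁ = 8 * pφ * pt) (hK₂ : K₂ = 128 * exp 1 * pp ^ 3 * pt ^ 4 * pφ * pκ / ((1 - ((2 : ℝ) ^ d)⁻¹) * pρ ^ 3)) (hKx : Kx = max K₁ K₂)
    (hq₀₀ : q₀₀ = 1 + (i₂ + x₆) * Kx) (hQH : QH = pZ * qb + q₀₀ + 1) (hBfW : BfW = (pW + pκ) * ab * QH * Kx) (hBf : max 1 BfW ≤ Bf)
    (hyP : yP = i₂ / (2 * q₀₀) + x₆ / (4 * q₀₀ ^ 2) + (pW + pκ) * ab * QH / (2 * Bf ^ 2)) (hyL : yL = (pW + pκ) * ab * q₀₀ / (2 * Bf ^ 2))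
    (haP : aP = (pW + pκ) * ab / Bf ^ 2 + 2 * yP / q₀₀) (haA : aA = 2 * yP / (pκ * q₀₀)) (haL : aL = 3 * yL / (2 * pκ * QH))
    (hi₃g : i₃g = x₆ + aP * QH ^ 3) (hsC : sC = i₂ / (2 * q₀₀) + i₃g / (4 * q₀₀ ^ 2) + aP * QH / 4)
    (hSfive : Sfive = exp 1 * pφ * pt * i₁ + exp 1 ^ 2 * pφ * pt ^ 2 * i₂ + exp 1 ^ 3 * pφ * pt ^ 3 * i₃g + pφ * aP * exp 1 ^ 2 * pt ^ 2 * QH ^ 2 / 2)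
    (hR₆ : R₆ = 1024 * ps * aP * QH / (aL * pρ ^ 3)) (hR₇ : R₇ = 64 * exp 1 * pp ^ 3 * pt ^ 4 * pφ * QH ^ 2 * i₁ ^ 2 / (aL * pρ ^ 3 * q₀₀ ^ 3))
    (huf : uf = min 1 (min (1 / (8 * ps * QH + 1)) (min (1 / (2 * exp 1 * pt * QH + 1)) (min (1 / (4 * pφ * pt * i₁ + 1))
      (min (1 / (2 * Sfive + 1)) (min (1 / (R₆ + 1)) (1 / (R₇ + 1))))))))
    (hqT : qT = Dinc * (1 + C₂r ^ 2 * (pρ * QH + qb) + 4 * QH + 2 * pt * pp * QH) / 4)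
    (haT : aT = C₁r / C₂r * (ab / Bf ^ 2 + aA) + Cinc * (aP + exp 1 * (i₁ + sC) / (2 * q₀₀)))
    (hCEf : CEf = qT * Bf * max 1 (2 * aT))
    (hblockW : max 1 pZ * C₂ ^ 2 * pρ ≤ (2 : ℝ) ^ (d - 1)) :
    0 < uf ∧ 0 ≤ CEf ∧ 1 ≤ Bf ∧
    ∀ (β : ℝ) (M : ℕ) [NeZero M], 0 < β → β ≤ M →
    -- the base datum: amplitude on its shape, the per-leg constant bounded on its shape
    ∀ (Ab Qb : ℝ), Ab = ab * (β / M) / Bf ^ 2 → 0 ≤ Qb → Qb ≤ qb * ((M : ℝ) / β) ^ 2 →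
    -- the names at the max-dominants (equational) and W10's pinned imports
    ∀ (κb αb crb ccb : ℝ), κb = Real.sqrt (2 * Cκ * klE0) → αb = Cb * ((M : ℝ) / β) * (4 : ℝ) ^ d / klE0 →
      crb = 81 * CJ * M / β → ccb = 162 * CJ * M / β →
    ∀ (W Z σ τ ψ Φ : ℝ), W = 32 * crb / ccb → Z = imagTimeWeight β M ^ 2 * ccb ^ 2 / 8 →
      σ = κb ^ 2 / ccb ^ 2 → τ = 4 * exp 4 * κb ^ 2 / ccb ^ 2 → ψ = ccb ^ 2 / κb ^ 2 → Φ = exp 1 * αb * ccb / (κb ^ 2 * crb) →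
    ∀ (ι₁ ι₂ ι₃ : ℝ), ι₁ = i₁ * ((M : ℝ) / β) → ι₂ = i₂ * ((M : ℝ) / β) ^ 3 → ι₃ = x₆ * ((M : ℝ) / β) ^ 5 →
    -- the (I5)-G choices (equational binders)
    ∀ (κA q₀ Q'' ρ Q' a X Y A A' : ℝ), κA = W * ((C₁ / C₂) * (8 : ℝ) ^ (d - 1)) → q₀ = q₀₀ * ((M : ℝ) / β) ^ 2 → Q'' = Z * Qb + q₀ + 1 →
      ρ = max 4 (2 * τ * ψ) → Q' = ρ * Q'' → a = W * Ab + κA * Ab → X = ι₃ / (W * Z ^ 3) →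
      Y = ι₂ / (2 * Q'') + W * Z ^ 3 * X / (4 * Q'' ^ 2) + a * Q'' / 2 → A = 2 * Y * (1 - ((2 : ℝ) ^ d)⁻¹) / (κA * Q'') → A' = a + 2 * Y / Q'' →
    -- (o) signs and W10's four dominations
    (0 ≤ A ∧ 0 < Q' ∧ 0 < Q'' ∧ 0 ≤ A' ∧
      W * ((C₁ / C₂) * (8 : ℝ) ^ (d - 1) * (Ab + A / (1 - ((2 : ℝ) ^ d)⁻¹))) ≤ A' ∧ Z * (C₂ ^ 2 * ((2 : ℝ) ^ (d - 1))⁻¹ * max Q' Qb) ≤ Q'' ∧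
      W * Ab ≤ A' ∧ Z * Qb ≤ Q'') ∧
    -- (i) the eight kit rows at every coupling below `uf`
    (∀ lam : ℝ, 0 ≤ lam → lam ≤ uf →
      4 * σ * lam * Q'' < 1 ∧ 2 * lam * τ * Q'' ≤ 1 ∧ exp 1 * τ * lam * Q'' < 1 ∧
      Φ * (τ * (ι₁ * lam + ι₂ / (2 * Q'') + ι₃ / (4 * Q'' ^ 2) + A' * Q'' / 4)) < 1 ∧
      Φ * (exp 1 * τ * (ι₁ * lam) + (exp 1 * τ) ^ 2 * (ι₂ * lam) + (exp 1 * τ) ^ 3 * (ι₃ * lam ^ 2) +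
        A' * (exp 1 * τ * Q'') * ((exp 1 * τ * lam * Q'') ^ 3 / (1 - exp 1 * τ * lam * Q''))) < 1 ∧
      4 * Q'' ≤ Q' ∧ 2 * τ * ψ * Q'' ≤ Q' ∧
      A' * (4 * Q'') ^ 3 * (4 * σ * lam * Q'' / (1 - 4 * σ * lam * Q'')) +
        exp 1 * ψ * (2 * τ * ψ * Q'') ^ 2 * (τ * (ι₁ * lam + ι₂ / (2 * Q'') + ι₃ / (4 * Q'' ^ 2) + A' * Q'' / 4)) *
          (Φ * (τ * (ι₁ * lam + ι₂ / (2 * Q'') + ι₃ / (4 * Q'' ^ 2) + A' * Q'' / 4)) /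
            (1 - Φ * (τ * (ι₁ * lam + ι₂ / (2 * Q'') + ι₃ / (4 * Q'' ^ 2) + A' * Q'' / 4)))) ≤ A * Q' ^ 3) ∧
    -- (ii) the CE row in the SHARP read-out shapes
    (∀ lam : ℝ, 0 ≤ lam → lam ≤ uf → ∀ (Aro Qro Qtot Atot : ℝ), Aro = C₁r / C₂r * (Ab + A) → Qro = C₂r ^ 2 * max Q' Qb →
      Qtot = Dinc * max 1 (max Qro (max (4 * Q'') (2 * τ * ψ * Q''))) →
      Atot = Aro + Cinc * (A' * (4 * σ * lam * Q'' / (1 - 4 * σ * lam * Q'')) +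
        exp 1 * (τ * (ι₁ * lam + ι₂ / (2 * Q'') + ι₃ / (4 * Q'' ^ 2) + A' * Q'' / 4)) *
          (Φ * (τ * (ι₁ * lam + ι₂ / (2 * Q'') + ι₃ / (4 * Q'' ^ 2) + A' * Q'' / 4)) /
            (1 - Φ * (τ * (ι₁ * lam + ι₂ / (2 * Q'') + ι₃ / (4 * Q'' ^ 2) + A' * Q'' / 4)))) / (2 * τ * Q'')) →
      Qtot * imagTimeWeight β M ^ 2 * Bf * max 1 (Atot / imagTimeWeight β M) ≤ CEf) := by
  -- §0 positivity of the r-free closed forms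
  have he0 : (0 : ℝ) < klE0 := by norm_num [klE0]
  have hrG1 : ((2 : ℝ) ^ d)⁻¹ < 1 := inv_lt_one_of_one_lt₀ (one_lt_pow₀ (by norm_num) (by omega))
  have hrG0 : 0 < 1 - ((2 : ℝ) ^ d)⁻¹ := sub_pos.2 hrG1
  have h2d1 : (0 : ℝ) < (2 : ℝ) ^ d - 1 := by have := one_lt_pow₀ (by norm_num : (1 : ℝ) < 2) (by omega : d ≠ 0); linarith
  have h2dne : (2 : ℝ) ^ d - 1 ≠ 0 := h2d1.ne'
  have hquarter : ∀ t s : ℝ, 0 ≤ t → 0 ≤ s → s ≤ 1 / (4 * t + 1) → t * s ≤ 1 / 4 := by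
    intro t s ht hs hs1
    have h1 : t * s ≤ t * (1 / (4 * t + 1)) := mul_le_mul_of_nonneg_left hs1 ht
    have h2 : t * (1 / (4 * t + 1)) ≤ 1 / 4 := by
      rw [mul_one_div, div_le_iff₀ (by positivity)]; linarith
    exact h1.trans h2
  have hpW0 : 0 < pW := by rw [hpW]; norm_num
  have hpZ0 : 0 < pZ := by rw [hpZ]; positivity
  have hps0 : 0 < ps := by rw [hps]; positivity
  have hpt0 : 0 < pt := by rw [hpt]; positivity
  have hpp0 : 0 < pp := by rw [hpp]; positivity
  have hpφ0 : 0 < pφ := by rw [hpφ]; positivity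
  have hpρ0 : 0 < pρ := by rw [hpρ]; positivity
  have hpκ0 : 0 < pκ := by rw [hpκ]; positivity
  have hK₁0 : 0 < K₁ := by rw [hK₁]; positivity
  have hK₂0 : 0 < K₂ := by rw [hK₂]; positivity
  have hKx0 : 0 < Kx := by rw [hKx]; exact lt_max_of_lt_left hK₁0
  have hq₀₀1 : 1 ≤ q₀₀ := by rw [hq₀₀]; nlinarith [mul_nonneg (add_nonneg hi₂ hx₆) hKx0.le]
  have hq₀₀0 : 0 < q₀₀ := lt_of_lt_of_le one_pos hq₀₀1
  have hQH0 : 0 < QH := by rw [hQH]; positivity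
  have hBf1 : 1 ≤ Bf := (le_max_left _ _).trans hBf
  have hBf0 : 0 < Bf := lt_of_lt_of_le one_pos hBf1
  have hBfW_le : BfW ≤ Bf := (le_max_right _ _).trans hBf
  have hWκ0 : 0 ≤ (pW + pκ) * ab * QH := by positivity
  obtain ⟨hyP0, hyPK₁, hyPK₂⟩ := levNumW_yP_small hK₁0.le hKx hi₂ hx₆ hWκ0 hq₀₀ hBfW hBfW_le hBf1 hyP
  have hyL0 : 0 < yL := by rw [hyL]; positivity
  have haP0 : 0 ≤ aP := by rw [haP]; positivity
  have haA0 : 0 ≤ aA := by rw [haA]; positivity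
  have haL0 : 0 < aL := by rw [haL]; positivity
  have hi₃g0 : 0 ≤ i₃g := by rw [hi₃g]; positivity
  have hsC0 : 0 ≤ sC := by rw [hsC]; positivity
  have hSfive0 : 0 ≤ Sfive := by rw [hSfive]; positivity
  have hR₆0 : 0 ≤ R₆ := by rw [hR₆]; positivity
  have hR₇0 : 0 ≤ R₇ := by rw [hR₇]; positivity
  have huf0 : 0 < uf := by rw [huf]; positivity
  have hqT0 : 0 ≤ qT := by
    rw [hqT]; have : 0 ≤ Dinc := le_trans zero_le_one hDinc
    positivity
  have haT0 : 0 ≤ aT := by rw [haT]; positivity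
  have hCEf0 : 0 ≤ CEf := by rw [hCEf]; exact mul_nonneg (mul_nonneg hqT0 hBf0.le) (le_trans zero_le_one (le_max_left _ _))
  -- uf below each of its members
  have huf1 : uf ≤ 1 := by rw [huf]; exact min_le_left _ _
  have huf2 : uf ≤ 1 / (8 * ps * QH + 1) := by rw [huf]; exact (min_le_right _ _).trans (min_le_left _ _)
  have huf4 : uf ≤ 1 / (4 * pφ * pt * i₁ + 1) := by
    rw [huf]; exact (min_le_right _ _).trans ((min_le_right _ _).trans ((min_le_right _ _).trans (min_le_left _ _)))
  refine ⟨huf0, hCEf0, hBf1, ?_⟩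
  -- §1 the binders
  intro β M _ hβ hβM Ab Qb hAbs hQb0 hQbs κb αb crb ccb hκb hαb hcrb hccb W Z σ τ ψ Φ hW hZ hσ hτ hψ hΦ ι₁ ι₂ ι₃ hι₁ hι₂ hι₃
    κA q₀ Q'' ρ Q' a X Y A A' hκA hq₀ hQ'' hρ hQ' ha hX hY hA hA'
  have hM0 : (0 : ℝ) < M := Nat.cast_pos.2 (Nat.pos_of_ne_zero (NeZero.ne M))
  have hβ0 : β ≠ 0 := hβ.ne'
  have hMne : (M : ℝ) ≠ 0 := hM0.ne'
  set r : ℝ := β / M with hr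
  have hr0 : 0 < r := by positivity
  have hr1 : r ≤ 1 := by rw [hr, div_le_one hM0]; exact hβM
  have hMβ : (M : ℝ) / β = 1 / r := by rw [hr]; field_simp
  have hMβ2 : ((M : ℝ) / β) ^ 2 = 1 / r ^ 2 := by rw [hMβ]; field_simp
  have hitw : imagTimeWeight β M = r / 2 := by rw [imagTimeWeight, hr]; field_simp
  -- §2 the pins in closed form (`αb = Ca·(M/β)` with `Ca := Cb·4^d/e₀`), then eliminate `W Z σ Φ ψ τ ρ κA`
  have hαb' : αb = Cb * (4 : ℝ) ^ d / klE0 * ((M : ℝ) / β) := by rw [hαb]; ring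
  have hW' : W = pW := by rw [hpW]; exact levPinW_W hCJ.ne' hβ0 hMne hcrb hccb hW
  have hZ' : Z = pZ := by rw [hpZ]; exact levPinW_Z hβ0 hMne hccb hZ
  have hσ' : σ = ps * r ^ 2 := by rw [hps, hr]; exact levPinW_σ hCκ hCJ.ne' hβ0 hMne hκb hccb hσ
  have hτ' : τ = pt * r ^ 2 := by rw [hpt, hr]; exact levPinW_τ hCκ hCJ.ne' hβ0 hMne hκb hccb hτ
  have hψ' : ψ = pp / r ^ 2 := by rw [levPinW_ψ hCκ hCJ.ne' hβ0 hMne hκb hccb hψ, hMβ2, hpp]; ring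
  have hΦ' : Φ = pφ / r := by rw [levPinW_Φ hCκ hCJ.ne' hβ0 hMne hκb hαb' hcrb hccb hΦ, hMβ, hpφ]; ring
  have hρ' : ρ = pρ := by rw [hρ, hpρ]; exact levPinW_ρ hCκ hCJ.ne' hβ0 hMne hκb hccb hψ hτ
  clear hW hZ hσ hτ hψ hΦ hαb hαb'
  subst W Z σ Φ ψ τ
  have hκA' : κA = pκ := by rw [hκA, hpκ]
  clear hκA
  subst κA
  have hΦ0 : 0 ≤ pφ / r := by positivity
  have hτpos : 0 < pt * r ^ 2 := by positivity
  have hψ0 : 0 ≤ pp / r ^ 2 := by positivity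
  have hσ0 : 0 ≤ ps * r ^ 2 := by positivity
  -- §3 the shaped data
  have hAb' : Ab = ab * r / Bf ^ 2 := hAbs
  have hAbpos : 0 < Ab := by rw [hAb']; positivity
  have hQbhi : Qb ≤ qb / r ^ 2 := by rw [hMβ2, mul_one_div] at hQbs; exact hQbs
  have hq₀' : q₀ = q₀₀ / r ^ 2 := by rw [hq₀, hMβ2]; ring
  have hq₀0 : 0 ≤ q₀ := by rw [hq₀']; positivity
  obtain ⟨hQ'₁, hQ'1, hQ'₂⟩ := levNumW_Q'_bounds hr0 hr1 hpZ0.le hQb0 hQbhi hq₀₀0.le hq₀' hQ''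
  rw [← hQH] at hQ'₂
  have hQ'0 : 0 < Q'' := lt_of_lt_of_le one_pos hQ'1
  have hι₁0 : 0 ≤ ι₁ := by rw [hι₁]; positivity
  have hι₂0 : 0 ≤ ι₂ := by rw [hι₂]; positivity
  have hι₃0 : 0 ≤ ι₃ := by rw [hι₃]; positivity
  have hι₁r : ι₁ ≤ i₁ / r := by rw [hι₁, hMβ]; exact le_of_eq (by ring)
  have hι₂r : ι₂ ≤ i₂ / r ^ 3 := by
    have : ((M : ℝ) / β) ^ 3 = 1 / r ^ 3 := by rw [hMβ]; field_simp
    rw [hι₂, this]; exact le_of_eq (by ring)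
  have hι₂r1 : ι₂ ≤ i₂ / (1 * r ^ 3) := by rw [one_mul]; exact hι₂r
  have hι₃r : ι₃ ≤ x₆ / r ^ 5 := by
    have : ((M : ℝ) / β) ^ 5 = 1 / r ^ 5 := by rw [hMβ]; field_simp
    rw [hι₃, this]; exact le_of_eq (by ring)
  have hX0 : 0 ≤ X := by rw [hX]; positivity
  have hWZX : pW * pZ ^ 3 * X = ι₃ := by rw [hX]; field_simp
  -- `Y` two-sided, `A A′` bounds
  obtain ⟨hY₁, hY₂⟩ := levNumW_Y_bounds (a₁ := pW * Ab) (a₂ := Ab) hr0 hpW0 hpZ0 hpκ0.le hab0.le hBf1 hq₀₀0 hQ'₁ hQ'₂ hι₂0 hι₂r hι₃0 hι₃r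
    hX hAb' rfl rfl ha hY
  rw [← hyL] at hY₁
  rw [← hyP] at hY₂
  have hY0 : 0 ≤ Y := le_trans (by positivity) hY₁
  obtain ⟨hA₁, hA₂⟩ := levNum_A_bounds hr0 hd hpκ0 hq₀₀0 hyL0.le hY₁ hY₂ hQ'₁ hQ'₂ hA
  rw [← haL] at hA₁
  rw [← haA] at hA₂
  have hA0 : 0 ≤ A := le_trans (by positivity) hA₁
  obtain ⟨hA'0, hA'₂⟩ := levNumW_A'_bounds (a₁ := pW * Ab) (a₂ := Ab) hr0 hpW0 hpκ0.le hab0.le hBf1 hq₀₀0 hY0 hY₂ hQ'₁ hAb' rfl rfl ha hA'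
  rw [← haP] at hA'₂
  -- NumericsG's pinned six-leg slot `ι₃ᴳ = WZ³X + A′Q″³ ≥ ι₃` and its bound
  obtain ⟨ι₃G, hι₃G⟩ : ∃ x : ℝ, x = pW * pZ ^ 3 * X + A' * Q'' ^ 3 := ⟨_, rfl⟩
  have hι₃le : ι₃ ≤ ι₃G := by
    have : 0 ≤ A' * Q'' ^ 3 := by positivity
    rw [hι₃G, ← hWZX]; linarith
  have hι₃G0 : 0 ≤ ι₃G := hι₃0.trans hι₃le
  have hι₃Gr : ι₃G ≤ i₃g / r ^ 5 := by
    have hXr : X ≤ x₆ / (pW * pZ ^ 3) / (1 ^ 2 * r ^ 5) := by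
      rw [one_pow, one_mul, hX, div_right_comm]; exact div_le_div_of_nonneg_right hι₃r (by positivity)
    have h := levNum_ι₃_le (W := pW) (Z := pZ) (B := 1) (x₆ := x₆ / (pW * pZ ^ 3)) hr0 hpW0.le hpZ0.le le_rfl hXr hA'0 hA'₂ hQ'0 hQ'₂ hι₃G
    have heq : pW * pZ ^ 3 * (x₆ / (pW * pZ ^ 3)) / 1 ^ 2 + aP * QH ^ 3 = x₆ + aP * QH ^ 3 := by field_simp
    rw [heq, ← hi₃g] at h
    exact h
  -- §4 NumericsG's residual rows: blocking, the two amplitude rows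
  have hρe : max 4 (2 * (pt * r ^ 2) * (pp / r ^ 2)) = pρ := hρ.symm.trans hρ'
  have hQ'ρ : Q' = pρ * Q'' := by rw [hQ', hρ']
  have hblock := levNumW_block (Z := pZ) (τ := pt * r ^ 2) (ψ := pp / r ^ 2) (κQ := C₂ ^ 2 * ((2 : ℝ) ^ (d - 1))⁻¹) rfl hρe rfl hblockW
  have amp1 : 8 * (pφ / r) * (pt * r ^ 2) * Y ≤ 1 := by
    calc 8 * (pφ / r) * (pt * r ^ 2) * Y = 8 * pφ * pt * (Y * r) := by field_simp
      _ ≤ 8 * pφ * pt * yP := by gcongr; exact (le_div_iff₀ hr0).1 hY₂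
      _ = yP * K₁ := by rw [hK₁]; ring
      _ ≤ 1 := hyPK₁
  have amp2 : 128 * exp 1 * (pp / r ^ 2) ^ 3 * (pt * r ^ 2) ^ 4 * (pφ / r) * pκ * Y ≤ (1 - ((2 : ℝ) ^ d)⁻¹) * ρ ^ 3 := by
    have hYr : Y * r ≤ yP := (le_div_iff₀ hr0).1 hY₂
    rw [hρ']
    calc 128 * exp 1 * (pp / r ^ 2) ^ 3 * (pt * r ^ 2) ^ 4 * (pφ / r) * pκ * Y = 128 * exp 1 * pp ^ 3 * pt ^ 4 * pφ * pκ * (Y * r) := by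
          field_simp
      _ ≤ 128 * exp 1 * pp ^ 3 * pt ^ 4 * pφ * pκ * yP := by gcongr
      _ = yP * K₂ * ((1 - ((2 : ℝ) ^ d)⁻¹) * pρ ^ 3) := by rw [hK₂]; field_simp
      _ ≤ 1 * ((1 - ((2 : ℝ) ^ d)⁻¹) * pρ ^ 3) := mul_le_mul_of_nonneg_right hyPK₂ (by positivity)
      _ = (1 - ((2 : ℝ) ^ d)⁻¹) * pρ ^ 3 := one_mul _
  have ha₁pos : 0 < pW * Ab := by positivity
  have hrows := towerLevNumericsG_rows (κQ := C₂ ^ 2 * ((2 : ℝ) ^ (d - 1))⁻¹) hpW0 hpZ0 hpκ0 (by positivity) hrG1 hQb0 ha₁pos hAbpos.le hq₀0 hι₂0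
    hX0 hρ hQ'' hQ' ha hY hA hA' hι₃G hblock amp1 amp2
  obtain ⟨⟨_, hQpos, _, _, _, _⟩, ⟨hfl1, hfl2, hfl3, hfl4, _, _, _⟩, ⟨hc1, hc2⟩, hN4, _⟩ := hrows
  refine ⟨⟨hA0, hQpos, hQ'0, hA'0, ?_, ?_, hfl1, hfl3⟩, ?_, ?_⟩
  · calc pW * (C₁ / C₂ * (8 : ℝ) ^ (d - 1) * (Ab + A / (1 - ((2 : ℝ) ^ d)⁻¹))) = pκ * (Ab + A / (1 - ((2 : ℝ) ^ d)⁻¹)) := by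
          rw [hpκ]; ring
      _ ≤ A' := hfl2
  · calc pZ * (C₂ ^ 2 * ((2 : ℝ) ^ (d - 1))⁻¹ * max Q' Qb) = pZ * (C₂ ^ 2 * ((2 : ℝ) ^ (d - 1))⁻¹) * max Q' Qb := by ring
      _ ≤ Q'' := hfl4
  -- (i) the eight kit rows
  · intro lam hlam0 hlamuf
    -- the doors at the actual names, from `uf`
    have h2 := levNum_door2 (QH := QH) hr0 hps0.le rfl hQ'0 hQ'₂
    have h3 := levNum_door3 (QH := QH) hr0 hpt0.le rfl hQ'0 hQ'₂
    have h4 := levNum_door4 hr0 hpφ0.le hpt0.le rfl rfl hι₁0 hι₁r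
    have h5 := (levNum_door5 hr0 hpφ0.le hpt0.le le_rfl rfl rfl hι₁0 hι₁r hι₂0 hι₂r1 hι₃G0 hι₃Gr hA'0 hA'₂ hQ'0 hQ'₂).2
    rw [div_one, ← hSfive] at h5
    have h6 := levNum_door6 hr0 hps0.le rfl hQ'0 hQ'₂ haL0 hA₁ hA'0 hA'₂ hpρ0 hQ'ρ
    rw [← hR₆] at h6
    have h7 := levNum_door7 (t₀ := pt) hr0 hpp0.le hpφ0.le rfl rfl rfl hι₁0 hι₁r hq₀₀0 hQ'₁ hQ'₂ haL0 hA₁ hpρ0 hQ'ρ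
    rw [← hR₇] at h7
    have hbig : uf ≤ min 1 (min (1 / (8 * ps * QH + 1)) (min (1 / (2 * exp 1 * pt * QH + 1)) (min (1 / (4 * pφ * pt * i₁ + 1))
        (min (1 / (2 * Sfive + 1)) (min (1 / (R₆ + 1)) (1 / (R₇ + 1))))))) := le_of_eq huf
    have hle := hlamuf.trans (hbig.trans (min_le_min le_rfl (min_le_min h2 (min_le_min h3 (min_le_min h4 (min_le_min h5 (min_le_min h6 h7)))))))
    have hG := towerLevNumericsG_side_of_lam_le (κQ := C₂ ^ 2 * ((2 : ℝ) ^ (d - 1))⁻¹) hσ0 hΦ0 hψ0 hτpos hpW0 hpZ0 hpκ0 (by positivity) hrG1 hQb0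
      ha₁pos hAbpos.le hq₀0 hι₁0 hι₂0 hX0 hρ hQ'' hQ' ha hY hA hA' hι₃G hblock amp1 amp2 hlam0 hle
    obtain ⟨gx₁, gx₂, gx₃, gy, gθ, gclose⟩ := hG
    obtain ⟨my, mθ, mclose⟩ := levNumW_rows_mono (σ := ps * r ^ 2) (Q := Q') (A := A) hΦ0 hτpos.le hψ0 hQ'0.le hA'0 hlam0 hι₁0 hι₂0 hι₃0 hι₃le
    exact ⟨gx₁, gx₂, gx₃, my gy, mθ gθ, hc1, hc2, mclose gy gclose⟩
  -- (ii) the CE row, sharp shapes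
  · intro lam hlam0 hlamuf Aro Qro Qtot Atot hAro hQro hQtot hAtot
    have hlam1 : lam ≤ 1 := hlamuf.trans huf1
    obtain ⟨_, hx₁⟩ := levNum_x₁_le hr0 hps0.le rfl hQ'0 hQ'₂ hlam0 (hlamuf.trans huf2)
    -- `S ≤ (i₁λ + sC)/r` and `S ≤ (i₁ + sC)/r`
    have hx₆i : x₆ ≤ i₃g := by rw [hi₃g]; linarith [mul_nonneg haP0 (pow_nonneg hQH0.le 3)]
    have hι₃i : ι₃ ≤ i₃g / r ^ 5 := hι₃r.trans (div_le_div_of_nonneg_right hx₆i (by positivity))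
    have hS := levNum_S_le (B := 1) hr0 le_rfl hq₀₀0 hlam0 hι₁r hι₂0 hι₂r1 hι₃0 hι₃i hA'0 hA'₂ hQ'₁ hQ'₂
    have hS2 : ι₁ * lam + ι₂ / (2 * Q'') + ι₃ / (4 * Q'' ^ 2) + A' * Q'' / 4 ≤ (i₁ * lam + sC) / r := by
      rw [hsC]; exact hS.trans (le_of_eq (by ring))
    have hS0 : 0 ≤ ι₁ * lam + ι₂ / (2 * Q'') + ι₃ / (4 * Q'' ^ 2) + A' * Q'' / 4 := by positivity
    have hS' : ι₁ * lam + ι₂ / (2 * Q'') + ι₃ / (4 * Q'' ^ 2) + A' * Q'' / 4 ≤ (i₁ + sC) / r :=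
      hS2.trans (div_le_div_of_nonneg_right (add_le_add (mul_le_of_le_one_right hi₁ hlam1) le_rfl) hr0.le)
    -- `y ≤ 1/2`: the λ-free part is `≤ 1/4` (NumericsG at `ι₃ᴳ ≥ ι₃`), the `ι₁λ` part by door 4
    have hy : pφ / r * (pt * r ^ 2 * (ι₁ * lam + ι₂ / (2 * Q'') + ι₃ / (4 * Q'' ^ 2) + A' * Q'' / 4)) ≤ 1 / 2 := by
      have h41 : pφ / r * (pt * r ^ 2) * ι₁ * lam ≤ 1 / 4 := by
        have hlam4 : lam ≤ 1 / (4 * pφ * pt * i₁ + 1) := hlamuf.trans huf4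
        have hι₁' : ι₁ * r = i₁ := by rw [hι₁, hMβ]; field_simp
        have e1 : pφ / r * (pt * r ^ 2) * ι₁ * lam = pφ * pt * (ι₁ * r) * lam := by field_simp
        rw [e1, hι₁']
        have h0 : 0 ≤ pφ * pt * i₁ := by positivity
        have h3 : 4 * (pφ * pt * i₁) + 1 = 4 * pφ * pt * i₁ + 1 := by ring
        exact hquarter (pφ * pt * i₁) lam h0 hlam0 (by rw [h3]; exact hlam4)
      have h42 : pφ / r * (pt * r ^ 2 * (ι₂ / (2 * Q'') + ι₃ / (4 * Q'' ^ 2) + A' * Q'' / 4)) ≤ 1 / 4 := by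
        have hmono : ι₂ / (2 * Q'') + ι₃ / (4 * Q'' ^ 2) + A' * Q'' / 4 ≤ ι₂ / (2 * Q'') + ι₃G / (4 * Q'' ^ 2) + A' * Q'' / 4 := by
          have : ι₃ / (4 * Q'' ^ 2) ≤ ι₃G / (4 * Q'' ^ 2) := div_le_div_of_nonneg_right hι₃le (by positivity)
          linarith
        calc pφ / r * (pt * r ^ 2 * (ι₂ / (2 * Q'') + ι₃ / (4 * Q'' ^ 2) + A' * Q'' / 4))
            ≤ pφ / r * (pt * r ^ 2 * (ι₂ / (2 * Q'') + ι₃G / (4 * Q'' ^ 2) + A' * Q'' / 4)) := by gcongr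
          _ ≤ 1 / 4 := hN4
      calc pφ / r * (pt * r ^ 2 * (ι₁ * lam + ι₂ / (2 * Q'') + ι₃ / (4 * Q'' ^ 2) + A' * Q'' / 4))
          = pφ / r * (pt * r ^ 2) * ι₁ * lam + pφ / r * (pt * r ^ 2 * (ι₂ / (2 * Q'') + ι₃ / (4 * Q'' ^ 2) + A' * Q'' / 4)) := by ring
        _ ≤ 1 / 4 + 1 / 4 := add_le_add h41 h42
        _ = 1 / 2 := by norm_num
    have hAt := levNumW_Atot_le hr0 hτpos hq₀₀0 hQ'₁ hS0 hS' hx₁ hy hA₂ hA'0 hA'₂ hAb' hC₁r.le hC₂r hCinc.le hAro hAtot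
    rw [← haT] at hAt
    obtain ⟨hQtot0, hQt⟩ := levNumW_Qtot_le hr0 hr1 hpt0.le hpp0.le rfl rfl hQ'0 hQ'₂ hQb0 hQbhi hpρ0 hQ'ρ hDinc hQro hQtot
    rw [← hqT] at hQt
    rw [hitw, hCEf]
    exact levNum_CErow_le hr0 hBf1 hQtot0 hQt hAt

end Summit.HubbardSuperconductivity.HubbardSuperconductivity.Theorems.EngineV8

end
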